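import Summits.HodgeConjecture.HodgeConjecture.Theorems.VHCAbelianSchemesRoadSecantQuotientServedLefschetz
import HarnessLib

/-!
# Road b02 (`VHCAbelianSchemesRoad`, D-0059) — the served plane of the secant–quotient anchor EXPLICITLY: Deligne's divisor-polynomial
# basis `Ω₊(θ)³, Ω₋(θ)³` of the Weil plane of `(J × Ĵ, φ_d)` (crux `SemiregularSheafRepresentativesTwAtDiag`, item stmt-HodgeConjecture-19787,
# stub 2a″ `stub_anchorCarrier_63_secantQuotientPinned`)

research route conditional on HC_CM; not a corollary; Q11.4-sentence-2 already refuted in dim ≥ 3.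

THEOREMS ONLY (fact-free; no definition; no claim-tagged fact imported; `HC_CM` nowhere). Sequel of
`…SecantQuotientServedLefschetz` (p523449: every served class of the (pinned) secant–quotient anchor data is an algebraic LEFSCHETZ class of its
anchor). For the split anchor `(A × Â, φ_d)` of F4 (`Markman2025.weilOperator`, principal `Θ`) the tree's abstract square theorem
`HodgeTheory.weilClassesOf_eq_span_cupPowTwo_weilGenerator` (Deligne LNM 900 Lemma 4.5 ∕ Rem. 4.10), fed with the intertwining data of the
sequel's §1 (`q₂ = p₁`, `q₁ = φ_d ≫ p₁`, section `(𝟙, 0)`), names a BASIS of the Weil plane: the `g`-th cup powers of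
`Ω_± = R ± i√d·S`, `R = (φ_d ≫ p₁)^*θ − d·p₁^*θ`, `S = ((φ_d ≫ p₁) + p₁)^*θ − (φ_d ≫ p₁)^*θ − p₁^*θ` (`HodgeTheory.weilGenerator`), for ANY
`θ ∈ H²(A)` with `θ^g ≠ 0` (e.g. a polarisation class of `Θ`: hard Lefschetz). Hence the plane `ℂθ³ ⊕ (Weil plane)` in which stub 2a″'s served
classes live (card rev 4, gap (G3): «PRINT at ONE direction per pinned anchor; RESEARCH in every other direction») is KERNEL-EXPLICIT in cubic
DIVISOR polynomials on `J × Ĵ`, without the cohomological Orlov ∕ Chevalley map that b02 g89's memo (§6 O2, evidence n°25) priced as typer-sized: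
`q^*HW ⊗ ℂ = ℂ·Ω₊(θ_J)³ ⊕ ℂ·Ω₋(θ_J)³`. WHICH rational point of this plane print's direction `[e₁ + ē₁]` is remains the Chevalley-pairing
computation flagged there (not in print); nothing here decides it.

* §1 `weilClassesOf_weilOperator_eq_span` (any principally polarised `A` of dimension `g ≥ 1`, `d ≥ 1`, `θ^g ≠ 0`).
* §2 the datum's instance on `(J × Ĵ, φ_d)` (`SecantQuotientDatum.weilClassesOf_eq_span_weilGenerator`; `θ_J³ ≠ 0` for a polarisation class of
  the theta divisor, `cupPowTwo_three_ne_zero_of_isPolarizationClassOf`), and the membership form for a class of `weilClassesOf D.P D.ψ 3 D.d`.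
* §3 at a chart: a (pinned-)served class `γ` at `(X, θ)` has `q^*(e⁻¹)^*γ ∈ span_ℂ {Ω₊(θ_J)³, Ω₋(θ_J)³}` for every `θ_J` with `θ_J³ ≠ 0`.

What is NOT claimed: (2a″), (2b″), the rung, any cell, K-SR♭∃, VHC, `HC_AV`, HC; any carrier; the identification of print's direction.
References: [cite: Deligne1982HodgeCycles, §4 Lemma 4.5 and Remark 4.10] [cite: vanGeemen1994HodgeAV, 4.9 and §2.4]
[cite: Markman2025SecantWeil, §1.5 (p. 7), §3.2 and Thm. 1.4.1 (item 4)] [cite: VoisinHodgeI2002, Thm. 6.25].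
-/

noncomputable section

open CategoryTheory CategoryTheory.Limits AlgebraicGeometry Topology

namespace Summit.HodgeConjecture.HodgeConjecture.Ring2.SemiregularRepresentatives

set_option linter.dupNamespace false -- the cell's namespace repeats the summit name, as in every `Ring2*` file

open Literature.AlgebraicGeometry Literature.AlgebraicGeometry.Motives Literature.AlgebraicGeometry.Motives.AbelianVariety
open Literature.AlgebraicGeometry.HodgeTheory Literature.AlgebraicGeometry.Markman2025
open Literature.AlgebraicTopology.SingularHomology
open Literature.Geometry.Kaehler (HasHardLefschetzProperty)

variable {X : SchemeOver ℂ} {θ : complexBetti X 2} {γ : complexBetti X (2 * 3)}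

/-! ## §1 The split anchor `(A × Â, φ_d)`: `W_K ⊗ ℂ = ℂ·Ω₊(θ)^g ⊕ ℂ·Ω₋(θ)^g` -/

section SplitAnchorBasis

variable (A : AbelianVariety ℂ) {Θ : CartierDivisor A.X.left} (hΘ : Θ.IsAmple) (hK : A.KTheta Θ = ⊥) {d : ℕ}

/-- `L_c` is injective on `H¹(A)` for every `c` with `c² = −d`, `d ≥ 1` (the hypothesis shape of the abstract square theorems).
[cite: Deligne1982HodgeCycles, §4 Lemma 4.5] -/
theorem weilOperator_virtual_injective_of_sq (hd : 0 < d) (c : ℂ) (v : complexBetti A.X 1) (hc : c * c = -(d : ℂ))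
    (hv : complexBetti.map (weilOperator hΘ hK d ≫ AbelianVariety.fst A (A.dualOf Θ hΘ)).hom.hom.hom 1 v +
      c • complexBetti.map (AbelianVariety.fst A (A.dualOf Θ hΘ)).hom.hom.hom 1 v = 0) :
    v = 0 := by
  refine weilOperator_virtual_injective A hΘ hK d ?_ v hv
  rintro rfl
  rw [zero_mul, eq_comm, neg_eq_zero, Nat.cast_eq_zero] at hc
  omega

variable {A}

/-- **THE WEIL PLANE OF `(A × Â, φ_d)` HAS THE EXPLICIT BASIS `Ω₊(θ)^g, Ω₋(θ)^g`** (`θ ∈ H²(A)`, `θ^g ≠ 0`; `A` principally polarised of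
dimension `g ≥ 1`, `d ≥ 1`): `weilClassesOf (A × Â) φ_d g d = span_ℂ {Ω_{i√d}(θ)^g, Ω_{−i√d}(θ)^g}` with
`Ω_c(θ) = weilGenerator (φ_d ≫ p₁) p₁ d c θ`. [cite: Deligne1982HodgeCycles, §4 Lemma 4.5 and Remark 4.10] [cite: vanGeemen1994HodgeAV, 4.9]
[cite: Markman2025SecantWeil, §3.2] -/
theorem weilClassesOf_weilOperator_eq_span {g : ℕ} (hg : 0 < g) (hA : A.dim = g) (hd : 0 < d) {θ : complexBetti A.X 2}
    (hθ : cupPowTwo θ g ≠ 0) :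
    weilClassesOf (A.prod (A.dualOf Θ hΘ)) (weilOperator hΘ hK d) g d =
      Submodule.span ℂ
        {cupPowTwo (weilGenerator (weilOperator hΘ hK d ≫ AbelianVariety.fst A (A.dualOf Θ hΘ))
            (AbelianVariety.fst A (A.dualOf Θ hΘ)) d (Complex.I * (Real.sqrt d : ℂ)) θ) g,
          cupPowTwo (weilGenerator (weilOperator hΘ hK d ≫ AbelianVariety.fst A (A.dualOf Θ hΘ))
            (AbelianVariety.fst A (A.dualOf Θ hΘ)) d (-(Complex.I * (Real.sqrt d : ℂ))) θ) g} := by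
  have hP : (A.prod (A.dualOf Θ hΘ)).dim = 2 * g := by
    rw [AbelianVariety.dim_prod, AbelianVariety.dim_dualOf, hA]; ring
  exact weilClassesOf_eq_span_cupPowTwo_weilGenerator hg hA hP hd (weilOperator_comp_self_nsmul A hΘ hK d) rfl
    (weilOperator_comp_weilOperator_comp_fst A hΘ hK d) (weilOperator_virtual_injective_of_sq A hΘ hK hd) hθ

end SplitAnchorBasis

/-! ## §2 The datum's plane `q^*HW ⊗ ℂ` on `J × Ĵ` -/

namespace SecantQuotientDatum

variable (D : SecantQuotientDatum)

/-- A polarisation class `θ_J` of the theta divisor has `θ_J³ ≠ 0` on the threefold `J` (hard Lefschetz).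
[cite: VoisinHodgeI2002, Thm. 6.25] [cite: Lange2023AbelianVarietiesComplex, §2.1.1 (p. 68)] -/
theorem cupPowTwo_three_ne_zero_of_isPolarizationClassOf {θJ : complexBetti D.𝒥.J.X 2} (hθJ : D.𝒥.J.IsPolarizationClassOf D.Θ θJ) :
    cupPowTwo θJ 3 ≠ 0 :=
  cupPowTwo_ne_zero_of_hasHardLefschetzProperty (D.dim_J ▸ AbelianVariety.isSmoothProjective_holds (A := D.𝒥.J))
    (D.dim_J ▸ (hθJ.isPolarizationClass D.isAmple).hasHardLefschetz)

/-- **THE PLANE `q^*HW ⊗ ℂ` OF MARKMAN'S `(J × Ĵ, φ_d)` WITH ITS EXPLICIT BASIS**: for every `θ ∈ H²(J)` with `θ³ ≠ 0` (e.g. a polarisation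
class of `Θ`, `cupPowTwo_three_ne_zero_of_isPolarizationClassOf`), `weilClassesOf (J × Ĵ) φ_d 3 d = span_ℂ {Ω_{i√d}(θ)³, Ω_{−i√d}(θ)³}`.
[cite: Deligne1982HodgeCycles, §4 Lemma 4.5 and Remark 4.10] [cite: Markman2025SecantWeil, §1.5 (p. 7), §3.2 and Thm. 1.4.1 (item 4)] -/
theorem weilClassesOf_eq_span_weilGenerator {θ : complexBetti D.𝒥.J.X 2} (hθ : cupPowTwo θ 3 ≠ 0) :
    weilClassesOf (D.𝒥.J.prod (D.𝒥.J.dualOf D.Θ D.isAmple)) (weilOperator D.isAmple D.KTheta_eq_bot D.d) 3 D.d =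
      Submodule.span ℂ
        {cupPowTwo (weilGenerator (weilOperator D.isAmple D.KTheta_eq_bot D.d ≫ AbelianVariety.fst D.𝒥.J (D.𝒥.J.dualOf D.Θ D.isAmple))
            (AbelianVariety.fst D.𝒥.J (D.𝒥.J.dualOf D.Θ D.isAmple)) D.d (Complex.I * (Real.sqrt D.d : ℂ)) θ) 3,
          cupPowTwo (weilGenerator (weilOperator D.isAmple D.KTheta_eq_bot D.d ≫ AbelianVariety.fst D.𝒥.J (D.𝒥.J.dualOf D.Θ D.isAmple))
            (AbelianVariety.fst D.𝒥.J (D.𝒥.J.dualOf D.Θ D.isAmple)) D.d (-(Complex.I * (Real.sqrt D.d : ℂ))) θ) 3} :=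
  weilClassesOf_weilOperator_eq_span D.isAmple D.KTheta_eq_bot (by norm_num) D.dim_J (by have := D.four_le; omega) hθ

/-- **A served class, read on `J × Ĵ`, is a `ℂ`-combination of `Ω₊(θ_J)³` and `Ω₋(θ_J)³`** for ANY class `θ_J ∈ H²(J)` with `θ_J³ ≠ 0`:
the clause `q^*γ ∈ weilClassesOf D.P D.ψ 3 D.d` of the (pinned) anchor predicate, made explicit (`D.P`, `D.ψ` unfold to the split anchor).
[cite: Deligne1982HodgeCycles, §4 Remark 4.10] [cite: Markman2025SecantWeil, Thm. 1.4.1 (item 4)] -/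
theorem mem_span_weilGenerator_of_mem_weilClassesOf {γP : complexBetti D.P.X (2 * 3)} (hγ : γP ∈ weilClassesOf D.P D.ψ 3 D.d)
    {θ : complexBetti D.𝒥.J.X 2} (hθ : cupPowTwo θ 3 ≠ 0) :
    γP ∈ Submodule.span ℂ
        {cupPowTwo (weilGenerator (weilOperator D.isAmple D.KTheta_eq_bot D.d ≫ AbelianVariety.fst D.𝒥.J (D.𝒥.J.dualOf D.Θ D.isAmple))
            (AbelianVariety.fst D.𝒥.J (D.𝒥.J.dualOf D.Θ D.isAmple)) D.d (Complex.I * (Real.sqrt D.d : ℂ)) θ) 3,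
          cupPowTwo (weilGenerator (weilOperator D.isAmple D.KTheta_eq_bot D.d ≫ AbelianVariety.fst D.𝒥.J (D.𝒥.J.dualOf D.Θ D.isAmple))
            (AbelianVariety.fst D.𝒥.J (D.𝒥.J.dualOf D.Θ D.isAmple)) D.d (-(Complex.I * (Real.sqrt D.d : ℂ))) θ) 3} := by
  have h := D.weilClassesOf_eq_span_weilGenerator hθ
  exact h ▸ hγ

end SecantQuotientDatum

/-! ## §3 At a chart: the served classes on Deligne's coordinates -/

/-- **THE SERVED SET ON DELIGNE'S COORDINATES**: a (v3-)served class `γ` at a secant–quotient anchor `(X, θ)` comes with a datum `D`, a chart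
`e : X ≅ D.Y.X` and, for every `θ_J ∈ H²(J)` with `θ_J³ ≠ 0`, the membership `q^*(e⁻¹)^*γ ∈ span_ℂ {Ω₊(θ_J)³, Ω₋(θ_J)³}` — the plane
`ℂθ³ ⊕ (Weil plane)` of the card's (G3) words, coordinatised by cubic DIVISOR polynomials. [cite: Deligne1982HodgeCycles, §4 Remark 4.10]
[cite: Markman2025SecantWeil, Thm. 1.4.1 (item 4) and §1.5] -/
theorem IsSecantQuotientWeilClassAt.exists_mem_span_weilGenerator (h : IsSecantQuotientWeilClassAt X θ γ) :
    ∃ (D : SecantQuotientDatum) (e : X ≅ D.Y.X), ∀ (θJ : complexBetti D.𝒥.J.X 2), cupPowTwo θJ 3 ≠ 0 →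
      complexBetti.map D.q.hom.hom.hom (2 * 3) (complexBetti.map e.inv (2 * 3) γ) ∈ Submodule.span ℂ
        {cupPowTwo (weilGenerator (weilOperator D.isAmple D.KTheta_eq_bot D.d ≫ AbelianVariety.fst D.𝒥.J (D.𝒥.J.dualOf D.Θ D.isAmple))
            (AbelianVariety.fst D.𝒥.J (D.𝒥.J.dualOf D.Θ D.isAmple)) D.d (Complex.I * (Real.sqrt D.d : ℂ)) θJ) 3,
          cupPowTwo (weilGenerator (weilOperator D.isAmple D.KTheta_eq_bot D.d ≫ AbelianVariety.fst D.𝒥.J (D.𝒥.J.dualOf D.Θ D.isAmple))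
            (AbelianVariety.fst D.𝒥.J (D.𝒥.J.dualOf D.Θ D.isAmple)) D.d (-(Complex.I * (Real.sqrt D.d : ℂ))) θJ) 3} := by
  obtain ⟨D, e, -, -, -, -, -, hmem⟩ := h
  exact ⟨D, e, fun θJ hθJ ↦ D.mem_span_weilGenerator_of_mem_weilClassesOf hmem hθJ⟩

/-- The pinned form. [cite: Deligne1982HodgeCycles, §4 Remark 4.10] [cite: Markman2025SecantWeil, Thm. 1.4.1 (item 4) and §1.5] -/
theorem IsSecantQuotientWeilClassAtPinned.exists_mem_span_weilGenerator (h : IsSecantQuotientWeilClassAtPinned X θ γ) :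
    ∃ (D : SecantQuotientDatum) (e : X ≅ D.Y.X), ∀ (θJ : complexBetti D.𝒥.J.X 2), cupPowTwo θJ 3 ≠ 0 →
      complexBetti.map D.q.hom.hom.hom (2 * 3) (complexBetti.map e.inv (2 * 3) γ) ∈ Submodule.span ℂ
        {cupPowTwo (weilGenerator (weilOperator D.isAmple D.KTheta_eq_bot D.d ≫ AbelianVariety.fst D.𝒥.J (D.𝒥.J.dualOf D.Θ D.isAmple))
            (AbelianVariety.fst D.𝒥.J (D.𝒥.J.dualOf D.Θ D.isAmple)) D.d (Complex.I * (Real.sqrt D.d : ℂ)) θJ) 3,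
          cupPowTwo (weilGenerator (weilOperator D.isAmple D.KTheta_eq_bot D.d ≫ AbelianVariety.fst D.𝒥.J (D.𝒥.J.dualOf D.Θ D.isAmple))
            (AbelianVariety.fst D.𝒥.J (D.𝒥.J.dualOf D.Θ D.isAmple)) D.d (-(Complex.I * (Real.sqrt D.d : ℂ))) θJ) 3} :=
  h.toAt.exists_mem_span_weilGenerator

end Summit.HodgeConjecture.HodgeConjecture.Ring2.SemiregularRepresentatives

end
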